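import Mathlib
import Literature.Algebra.Polynomial.Subresultant
import Literature.Computability.AlgebraicComplexity.BurgisserReductionModPrimes
import HarnessLib

/-!
# Route GaugeDescent — `DescentGlue` (stmt-ValiantsHypothesis-6637), part D′: the denominator
# `M` has few prime factors

For the explicit denominator `M = |lc g| · λ · ∏_w max(1, |Res(g, v_w)|)` of part D
(`GaugeDescentDescentGlueIntegral.lean`), Bürgisser's height bounds (TCS 2000 Thm. 4.5:
`deg g, deg v_w ≤ T`, `log λ, log wt g, log wt v_w ≤ T · log w`) give
`ω(M) ≤ 4 (μ+1) T² log w` (`card_primeFactors_den_le`): `ω(M) log 2 ≤ log M`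
(`card_primeFactors_mul_log_two_le`), `|lc g| ≤ wt g`, and Hadamard's bound
`|Res(g, v)| ≤ ‖g‖₂^{deg v} ‖v‖₂^{deg g}` (the tree's `Subresultant.abs_subresultant_le_twoNorm_pow`)
with `‖·‖₂ ≤ ‖·‖₁ = wt`. Honest framing: bookkeeping; `VP ≠ VNP` is NOT proved.
-/

set_option linter.dupNamespace false

noncomputable section

namespace Summit.ValiantsHypothesis.ValiantsHypothesis.Theorems.GaugeDescent

open Polynomial Finset
open Literature.Algebra.Polynomial Literature.Algebra.Polynomial.MignotteBound
open Literature.Computability.AlgebraicComplexity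

namespace DescentGlue

/-- The `1`-norm of an integer polynomial is its weight. [folklore] -/
theorem oneNorm_eq_polyWeight (f : ℤ[X]) : oneNorm f = (polyWeight f : ℝ) := by
  unfold oneNorm polyWeight
  push_cast
  refine sum_congr rfl fun i _ => ?_
  rw [Int.norm_eq_abs, Nat.cast_natAbs, Int.cast_abs]

/-- `|lc f| ≤ wt f`. [folklore] -/
theorem natAbs_leadingCoeff_le_polyWeight (f : ℤ[X]) : f.leadingCoeff.natAbs ≤ polyWeight f := by
  by_cases hf : f = 0
  · simp [hf, polyWeight]
  · unfold polyWeight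
    exact single_le_sum (f := fun i => (f.coeff i).natAbs) (fun _ _ => Nat.zero_le _)
      (natDegree_mem_support_of_nonzero hf)

/-- **Hadamard's bound for the resultant in weights**: `|Res(g, v)| ≤ wt(g)^{deg v} · wt(v)^{deg g}`.
[cite: GathenGerhard1999, Theorem 6.50] -/
theorem abs_resultant_le_polyWeight_pow (g v : ℤ[X]) :
    |((resultant g v : ℤ) : ℝ)| ≤
      (polyWeight g : ℝ) ^ v.natDegree * (polyWeight v : ℝ) ^ g.natDegree := by
  have h := Subresultant.abs_subresultant_le_twoNorm_pow g v 0
  rw [Subresultant.subresultant_zero, Nat.sub_zero, Nat.sub_zero] at h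
  refine h.trans (mul_le_mul ?_ ?_ (pow_nonneg (twoNorm_nonneg _) _) (pow_nonneg (by positivity) _))
  · rw [← oneNorm_eq_polyWeight]
    exact pow_le_pow_left₀ (twoNorm_nonneg _) (twoNorm_le_oneNorm _) _
  · rw [← oneNorm_eq_polyWeight]
    exact pow_le_pow_left₀ (twoNorm_nonneg _) (twoNorm_le_oneNorm _) _

/-- The logarithm of one resultant factor of `M`: `log max(1, |Res(g, v)|) ≤ 2 T² log w`.
[cite: Burgisser2000TCS, Thm. 4.5 (height bookkeeping)] -/
theorem log_resFactor_le (g v : ℤ[X]) {T Lw : ℝ} (hT : 0 ≤ T)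
    (hg1 : (g.natDegree : ℝ) ≤ T) (hv1 : (v.natDegree : ℝ) ≤ T)
    (hg2 : Real.log (polyWeight g) ≤ T * Lw) (hv2 : Real.log (polyWeight v) ≤ T * Lw) :
    Real.log ((max 1 (resultant g v).natAbs : ℕ) : ℝ) ≤ 2 * T ^ 2 * Lw := by
  have hLw : 0 ≤ T * Lw := (Real.log_natCast_nonneg _).trans hg2
  by_cases hres : (resultant g v).natAbs ≤ 1
  · rw [max_eq_left hres, Nat.cast_one, Real.log_one]
    nlinarith
  · rw [not_le] at hres
    rw [max_eq_right hres.le]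
    have hpos : (0 : ℝ) < ((resultant g v).natAbs : ℝ) := by exact_mod_cast (by omega : 0 < _)
    have hb := abs_resultant_le_polyWeight_pow g v
    rw [← Int.cast_abs, ← Nat.cast_natAbs] at hb
    -- both factors of the bound are positive
    set P1 := (polyWeight g : ℝ) ^ v.natDegree
    set P2 := (polyWeight v : ℝ) ^ g.natDegree
    have hP : 0 < P1 * P2 := hpos.trans_le hb
    have hP1n : 0 ≤ P1 := pow_nonneg (Nat.cast_nonneg _) _
    have hP2n : 0 ≤ P2 := pow_nonneg (Nat.cast_nonneg _) _
    have hP1 : 0 < P1 := by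
      rcases hP1n.lt_or_eq with h | h
      · exact h
      · exfalso; rw [← h, zero_mul] at hP; exact lt_irrefl _ hP
    have hP2 : 0 < P2 := by
      rcases hP2n.lt_or_eq with h | h
      · exact h
      · exfalso; rw [← h, mul_zero] at hP; exact lt_irrefl _ hP
    calc Real.log ((resultant g v).natAbs : ℝ) ≤ Real.log (P1 * P2) := Real.log_le_log hpos hb
      _ = v.natDegree * Real.log (polyWeight g) + g.natDegree * Real.log (polyWeight v) := by
          rw [Real.log_mul hP1.ne' hP2.ne', Real.log_pow, Real.log_pow]
      _ ≤ T * (T * Lw) + T * (T * Lw) :=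
          add_le_add (mul_le_mul hv1 hg2 (Real.log_natCast_nonneg _) hT)
            (mul_le_mul hg1 hv2 (Real.log_natCast_nonneg _) hT)
      _ = 2 * T ^ 2 * Lw := by ring

/-- **The denominator has few prime factors**: with Bürgisser's bounds `deg g, deg v_w ≤ T`,
`log λ, log wt g, log wt v_w ≤ T · log w` (`T ≥ 1`), the number of distinct prime factors of
`M = |lc g| · λ · ∏_w max(1, |Res(g, v_w)|)` is `≤ 4 (μ+1) T² log w`.
[cite: Burgisser2000TCS, Thm. 4.5 and §5 (A3)] -/
theorem card_primeFactors_den_le {μ lam : ℕ} (hlam : 0 < lam) (v : Fin μ → ℤ[X]) {g : ℤ[X]}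
    (hg : g ≠ 0) {T Lw : ℝ} (hT : 1 ≤ T)
    (hg1 : (g.natDegree : ℝ) ≤ T) (hv1 : ∀ j, ((v j).natDegree : ℝ) ≤ T)
    (hlam2 : Real.log lam ≤ T * Lw) (hg2 : Real.log (polyWeight g) ≤ T * Lw)
    (hv2 : ∀ j, Real.log (polyWeight (v j)) ≤ T * Lw) :
    (((g.leadingCoeff.natAbs * lam * ∏ w, max 1 (resultant g (v w)).natAbs : ℕ)).primeFactors.card
        : ℝ) ≤ 4 * (μ + 1) * T ^ 2 * Lw := by
  set c : ℕ := g.leadingCoeff.natAbs with hc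
  set R : Fin μ → ℕ := fun w => max 1 (resultant g (v w)).natAbs with hR
  have hT0 : 0 ≤ T := zero_le_one.trans hT
  have hLw : 0 ≤ T * Lw := (Real.log_natCast_nonneg _).trans hg2
  have hLw0 : 0 ≤ Lw := by
    by_contra h
    push Not at h
    have : T * Lw < 0 := mul_neg_of_pos_of_neg (by linarith) h
    linarith
  have hc1 : 1 ≤ c := Int.natAbs_pos.mpr (leadingCoeff_ne_zero.mpr hg)
  have hR1 : ∀ w, 1 ≤ R w := fun w => le_max_left _ _
  have hM : 0 < c * lam * ∏ w, R w :=
    Nat.mul_pos (Nat.mul_pos hc1 hlam) (prod_pos fun w _ => hR1 w)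
  -- `ω(M) log 2 ≤ log M`
  have h1 := card_primeFactors_mul_log_two_le hM
  -- `log M = log c + log λ + ∑ log R_w`
  have hne : ∀ w ∈ (univ : Finset (Fin μ)), ((R w : ℕ) : ℝ) ≠ 0 := fun w _ => by
    exact_mod_cast Nat.one_le_iff_ne_zero.mp (hR1 w)
  have hlogM : Real.log ((c * lam * ∏ w, R w : ℕ) : ℝ) =
      Real.log c + Real.log lam + ∑ w, Real.log (R w : ℝ) := by
    push_cast
    rw [Real.log_mul (by positivity) (by positivity), Real.log_mul (by positivity) (by positivity),
      Real.log_prod hne]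
  -- the pieces
  have hlogc : Real.log c ≤ T * Lw := by
    refine le_trans (Real.log_le_log (by exact_mod_cast hc1) ?_) hg2
    exact_mod_cast natAbs_leadingCoeff_le_polyWeight g
  have hlogR : ∀ w, Real.log (R w : ℝ) ≤ 2 * T ^ 2 * Lw := fun w =>
    log_resFactor_le g (v w) hT0 hg1 (hv1 w) hg2 (hv2 w)
  have hsum : ∑ w, Real.log (R w : ℝ) ≤ μ * (2 * T ^ 2 * Lw) := by
    calc ∑ w, Real.log (R w : ℝ) ≤ ∑ _w : Fin μ, 2 * T ^ 2 * Lw := sum_le_sum fun w _ => hlogR w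
      _ = μ * (2 * T ^ 2 * Lw) := by
          rw [sum_const, card_univ, Fintype.card_fin, nsmul_eq_mul]
  have hTT : T * Lw ≤ T ^ 2 * Lw := by nlinarith
  have hlogM_le : Real.log ((c * lam * ∏ w, R w : ℕ) : ℝ) ≤ 2 * (μ + 1) * T ^ 2 * Lw := by
    rw [hlogM]
    nlinarith
  have hlog2 : (1 : ℝ) / 2 ≤ Real.log 2 := by
    have := Real.log_two_gt_d9
    linarith
  set k : ℕ := (c * lam * ∏ w, R w).primeFactors.card
  have hk0 : (0 : ℝ) ≤ k := Nat.cast_nonneg _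
  have hk : (k : ℝ) * (1 / 2) ≤ (k : ℝ) * Real.log 2 := mul_le_mul_of_nonneg_left hlog2 hk0
  have : (k : ℝ) * Real.log 2 ≤ 2 * (μ + 1) * T ^ 2 * Lw := h1.trans hlogM_le
  linarith

end DescentGlue

end Summit.ValiantsHypothesis.ValiantsHypothesis.Theorems.GaugeDescent

end
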